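import Literature.Geometry.Lorentzian.GeodesicProofs
import HarnessLib

/-!
# The partial velocity of a smooth family `N × ℝ → M` has a smooth lift to `TM`

Topic `Literature/Geometry/Lorentzian` (namespace `Literature.Geometry.Lorentzian`), a companion
of `TwoParameterMaps.lean` (which treats maps `ℝ × ℝ → M`). For a map `f : N × ℝ → M` (a
one-parameter family of maps `f(·, t) : N → M`, e.g. the normal exponential map
`(z, t) ↦ exp_{ι z}(t ν z)` of a hypersurface, layer L2 of the programme of
`Literature.Geometry.Riemannian.BaerHankePscGluing`: Bär–Hanke 2023, §3, the families `g_t`,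
`ġ_t` on the level hypersurfaces `N_t`), which is `C^∞` at `(y₀, t₀)`, the **partial velocity in
the parameter**, `∂_t f(y, t) = velocity (t ↦ f(y, t))`, lifts to a map
`(y, t) ↦ (f(y, t), ∂_t f(y, t)) ∈ TM` which is `C^∞` at `(y₀, t₀)`
(`contMDiffAt_lift_partialVelocity`): read in the trivialisation of `TM` at `f(y₀, t₀)` and the
chart of `N` at `y₀` (boundaryless model), the fibre coordinate is the partial derivative in `t`
of the `C^∞` chart expression `(a, t) ↦ φ_M(f(φ_N⁻¹ a, t))`, a `C^∞` function
(`ContDiffAt.fderiv`). In particular each slice `y ↦ (f(y, t₀), ∂_t f(y, t₀))` is `C^∞`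
(`contMDiffAt_lift_partialVelocity_slice`) — the regularity of the "velocity field" `∂_t f` along
the immersion `f(·, t₀)` needed to speak of its second fundamental form
(`PseudoRiemannianMetric.secondFundamentalForm_apply`). O'Neill 1983, Ch. 4, p. 122 (partial
velocities of smooth families are smooth vector fields on the map).

No definitions, no named facts (D-0026).

## References

* B. O'Neill, *Semi-Riemannian geometry* (1983), Ch. 4, p. 122. [ONeill1983]
* C. Bär, B. Hanke, *Boundary conditions for scalar curvature*, arXiv:2012.09127, §3. [BarHanke2023]
-/

noncomputable section

open Bundle Set Filter Function
open scoped Manifold ContDiff Topology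

namespace Literature.Geometry.Lorentzian

variable {E : Type*} [NormedAddCommGroup E] [NormedSpace ℝ E] {H : Type*} [TopologicalSpace H]
  {I : ModelWithCorners ℝ E H} {M : Type*} [TopologicalSpace M] [ChartedSpace H M]
  [IsManifold I ∞ M]
  {E' : Type*} [NormedAddCommGroup E'] [NormedSpace ℝ E'] {H' : Type*} [TopologicalSpace H']
  {I' : ModelWithCorners ℝ E' H'} [I'.Boundaryless] {N : Type*} [TopologicalSpace N]
  [ChartedSpace H' N] [IsManifold I' ∞ N]

/-- **The chart expression of a smooth family is smooth.** For `f : N × ℝ → M` of class `C^∞` at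
`q = (y, t)` with `y` in the chart domain of `y₀` and `f q` in the chart domain of `x₁`, the map
`(a, t) ↦ φ_M(f(φ_N⁻¹ a, t))` (`φ_N`, `φ_M` the extended charts at `y₀` and `x₁`; boundaryless
model on `N`) is `C^∞` at `(φ_N y, t)` in the vector-space sense. [folklore] -/
theorem contDiffAt_extChartAt_family {f : N × ℝ → M} {y₀ : N} {x₁ : M} {q : N × ℝ}
    (hf : ContMDiffAt (I'.prod 𝓘(ℝ, ℝ)) I ∞ f q) (hq1 : q.1 ∈ (chartAt H' y₀).source)
    (hq2 : f q ∈ (chartAt H x₁).source) :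
    ContDiffAt ℝ ∞ (fun r : E' × ℝ ↦ extChartAt I x₁ (f ((extChartAt I' y₀).symm r.1, r.2)))
      (extChartAt I' y₀ q.1, q.2) := by
  have hq1' : q.1 ∈ (extChartAt I' y₀).source := by rwa [extChartAt_source]
  -- `(a, t) ↦ (φ_N⁻¹ a, t)` is `C^∞` at `(φ_N q.1, q.2)` as a map `E' × ℝ → N × ℝ`
  have h1 : ContMDiffAt 𝓘(ℝ, E') I' ∞ (extChartAt I' y₀).symm (extChartAt I' y₀ q.1) :=
    (contMDiffOn_extChartAt_symm y₀).contMDiffAt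
      ((isOpen_extChartAt_target y₀).mem_nhds ((extChartAt I' y₀).map_source hq1'))
  have h2 : ContMDiffAt (𝓘(ℝ, E').prod 𝓘(ℝ, ℝ)) (I'.prod 𝓘(ℝ, ℝ)) ∞
      (fun r : E' × ℝ ↦ (((extChartAt I' y₀).symm r.1, r.2) : N × ℝ)) (extChartAt I' y₀ q.1, q.2) :=
    (h1.comp (extChartAt I' y₀ q.1, q.2) contMDiffAt_fst).prodMk contMDiffAt_snd
  have hpt : (((extChartAt I' y₀).symm (extChartAt I' y₀ q.1), q.2) : N × ℝ) = q := by
    rw [(extChartAt I' y₀).left_inv hq1']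
  have h3 : ContMDiffAt (I'.prod 𝓘(ℝ, ℝ)) I ∞ f
      ((fun r : E' × ℝ ↦ (((extChartAt I' y₀).symm r.1, r.2) : N × ℝ))
        (extChartAt I' y₀ q.1, q.2)) := by
    show ContMDiffAt (I'.prod 𝓘(ℝ, ℝ)) I ∞ f ((extChartAt I' y₀).symm (extChartAt I' y₀ q.1), q.2)
    rw [hpt]
    exact hf
  have h4 : ContMDiffAt I 𝓘(ℝ, E) ∞ (extChartAt I x₁)
      (f ((fun r : E' × ℝ ↦ (((extChartAt I' y₀).symm r.1, r.2) : N × ℝ))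
        (extChartAt I' y₀ q.1, q.2))) := by
    show ContMDiffAt I 𝓘(ℝ, E) ∞ (extChartAt I x₁)
      (f ((extChartAt I' y₀).symm (extChartAt I' y₀ q.1), q.2))
    rw [hpt]
    exact contMDiffAt_extChartAt' hq2
  have h5 := (h4.comp _ h3).comp (extChartAt I' y₀ q.1, q.2) h2
  have h6 : ContMDiffAt 𝓘(ℝ, E' × ℝ) 𝓘(ℝ, E) ∞
      (fun r : E' × ℝ ↦ extChartAt I x₁ (f ((extChartAt I' y₀).symm r.1, r.2)))
      (extChartAt I' y₀ q.1, q.2) := by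
    rw [modelWithCornersSelf_prod, ← chartedSpaceSelf_prod]
    exact h5
  exact contMDiffAt_iff_contDiffAt.1 h6

/-- **The partial velocity of a smooth family lifts smoothly to `TM`.** For `f : N × ℝ → M` of
class `C^∞` near `(y₀, t₀)` (i.e. on a neighbourhood), the map
`(y, t) ↦ (f(y, t), ∂_t f(y, t)) ∈ TM`, `∂_t f(y, t) = velocity (t ↦ f(y, t)) t`, is `C^∞` at
`(y₀, t₀)`: in the trivialisation at `f(y₀, t₀)` its fibre coordinate is, near `(y₀, t₀)`, the
partial `t`-derivative of the chart expression, read through the chart of `N` at `y₀`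
(`hasDerivAt_extChartAt_comp`, `ContDiffAt.fderiv`). O'Neill 1983, Ch. 4, p. 122.
[cite: ONeill1983, Ch. 4, p. 122] -/
theorem contMDiffAt_lift_partialVelocity {f : N × ℝ → M} {y₀ : N} {t₀ : ℝ}
    (hf : ∀ᶠ q in 𝓝 (y₀, t₀), ContMDiffAt (I'.prod 𝓘(ℝ, ℝ)) I ∞ f q) :
    ContMDiffAt (I'.prod 𝓘(ℝ, ℝ)) I.tangent ∞
      (fun q : N × ℝ ↦ (TotalSpace.mk' E (f q) (velocity I (fun t : ℝ ↦ f (q.1, t)) q.2) :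
        TangentBundle I M)) (y₀, t₀) := by
  have hf₀ : ContMDiffAt (I'.prod 𝓘(ℝ, ℝ)) I ∞ f (y₀, t₀) := hf.self_of_nhds
  set e := trivializationAt E (TangentSpace I : M → Type _) (f (y₀, t₀)) with he_def
  set φ := extChartAt I' y₀ with hφ
  set ψ := extChartAt I (f (y₀, t₀)) with hψ
  have hmem : (TotalSpace.mk' E (f (y₀, t₀)) (velocity I (fun t : ℝ ↦ f (y₀, t)) t₀) :
      TangentBundle I M) ∈ e.source :=
    e.mem_source.2 (FiberBundle.mem_baseSet_trivializationAt' (f (y₀, t₀)))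
  rw [e.contMDiffAt_iff
    (f := fun q : N × ℝ ↦ (TotalSpace.mk' E (f q) (velocity I (fun t : ℝ ↦ f (q.1, t)) q.2) :
      TangentBundle I M)) hmem]
  refine ⟨hf₀, ?_⟩
  -- the chart expression `G (a, t) = ψ (f (φ⁻¹ a, t))`, smooth at `(φ y₀, t₀)`
  set G : E' × ℝ → E := fun r ↦ ψ (f (φ.symm r.1, r.2)) with hG
  have hGs : ContDiffAt ℝ ∞ G (φ y₀, t₀) :=
    contDiffAt_extChartAt_family (q := (y₀, t₀)) hf₀ (mem_chart_source H' y₀)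
      (mem_chart_source H (f (y₀, t₀)))
  -- its partial `t`-derivative `r ↦ DG(r)(0, 1)` is smooth at `(φ y₀, t₀)`
  have hD : ContDiffAt ℝ ∞ (fun r : E' × ℝ ↦ fderiv ℝ G r ((0 : E'), (1 : ℝ))) (φ y₀, t₀) :=
    (hGs.fderiv_right (m := ∞) (by exact_mod_cast le_rfl)).clm_apply contDiffAt_const
  -- read back on `N × ℝ` through `q ↦ (φ q.1, q.2)`
  have hΦ : ContMDiffAt (I'.prod 𝓘(ℝ, ℝ)) (𝓘(ℝ, E').prod 𝓘(ℝ, ℝ)) ∞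
      (fun q : N × ℝ ↦ ((φ q.1, q.2) : E' × ℝ)) (y₀, t₀) := by
    have h1 : ContMDiffAt I' 𝓘(ℝ, E') ∞ φ (Prod.fst (y₀, t₀)) :=
      contMDiffAt_extChartAt' (mem_chart_source H' y₀)
    exact (h1.comp (y₀, t₀) contMDiffAt_fst).prodMk contMDiffAt_snd
  have hD' : ContMDiffAt (𝓘(ℝ, E').prod 𝓘(ℝ, ℝ)) 𝓘(ℝ, E) ∞
      (fun r : E' × ℝ ↦ fderiv ℝ G r ((0 : E'), (1 : ℝ))) ((fun q : N × ℝ ↦ ((φ q.1, q.2) : E' × ℝ)) (y₀, t₀)) := by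
    have h := contMDiffAt_iff_contDiffAt.2 hD
    rw [modelWithCornersSelf_prod, ← chartedSpaceSelf_prod] at h
    exact h
  have hcomp : ContMDiffAt (I'.prod 𝓘(ℝ, ℝ)) 𝓘(ℝ, E) ∞
      (fun q : N × ℝ ↦ fderiv ℝ G (φ q.1, q.2) ((0 : E'), (1 : ℝ))) (y₀, t₀) := hD'.comp (y₀, t₀) hΦ
  -- and agrees with the fibre coordinate near `(y₀, t₀)`
  have hsrc : ∀ᶠ q : N × ℝ in 𝓝 (y₀, t₀), f q ∈ (chartAt H (f (y₀, t₀))).source :=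
    hf₀.continuousAt.preimage_mem_nhds
      ((chartAt H (f (y₀, t₀))).open_source.mem_nhds (mem_chart_source H (f (y₀, t₀))))
  have hsrcN : ∀ᶠ q : N × ℝ in 𝓝 (y₀, t₀), q.1 ∈ (chartAt H' y₀).source :=
    continuousAt_fst.preimage_mem_nhds
      ((chartAt H' y₀).open_source.mem_nhds (mem_chart_source H' y₀))
  have hGd : ∀ᶠ q : N × ℝ in 𝓝 (y₀, t₀), DifferentiableAt ℝ G (φ q.1, q.2) := by
    filter_upwards [hf, hsrc, hsrcN] with q hq hqs hqN
    exact (contDiffAt_extChartAt_family (y₀ := y₀) (x₁ := f (y₀, t₀)) hq hqN hqs).differentiableAt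
      (by simp)
  have heq : (fun q : N × ℝ ↦ fderiv ℝ G (φ q.1, q.2) ((0 : E'), (1 : ℝ))) =ᶠ[𝓝 (y₀, t₀)]
      fun q : N × ℝ ↦ (e ⟨f q, velocity I (fun t : ℝ ↦ f (q.1, t)) q.2⟩).2 := by
    filter_upwards [hf, hsrc, hsrcN, hGd] with q hq hqs hqN hqG
    -- the `t`-curve through `q` and its chart expression
    have hγ : MDifferentiableAt 𝓘(ℝ, ℝ) I (fun t : ℝ ↦ f (q.1, t)) q.2 := by
      have h : ContMDiffAt 𝓘(ℝ, ℝ) (I'.prod 𝓘(ℝ, ℝ)) ∞ (fun t : ℝ ↦ ((q.1, t) : N × ℝ)) q.2 :=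
        contMDiffAt_const.prodMk contMDiffAt_id
      have hq' : ContMDiffAt (I'.prod 𝓘(ℝ, ℝ)) I ∞ f ((fun t : ℝ ↦ ((q.1, t) : N × ℝ)) q.2) := hq
      exact (hq'.comp q.2 h).mdifferentiableAt (by simp)
    have h1 : HasDerivAt (ψ ∘ fun t : ℝ ↦ f (q.1, t))
        ((e ⟨f q, velocity I (fun t : ℝ ↦ f (q.1, t)) q.2⟩).2) q.2 :=
      hasDerivAt_extChartAt_comp hγ hqs
    -- the same curve through `G`
    have hfun : (ψ ∘ fun t : ℝ ↦ f (q.1, t)) = fun t : ℝ ↦ G (φ q.1, t) := by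
      funext t
      show ψ (f (q.1, t)) = ψ (f (φ.symm (φ q.1), t))
      rw [φ.left_inv (by rw [hφ, extChartAt_source]; exact hqN)]
    have h2 : HasDerivAt (fun t : ℝ ↦ G (φ q.1, t)) (fderiv ℝ G (φ q.1, q.2) ((0 : E'), (1 : ℝ))) q.2 := by
      have hc : HasDerivAt (fun t : ℝ ↦ ((φ q.1, t) : E' × ℝ)) ((0 : E'), (1 : ℝ)) q.2 :=
        (hasDerivAt_const q.2 (φ q.1)).prodMk (hasDerivAt_id q.2)
      exact hqG.hasFDerivAt.comp_hasDerivAt q.2 hc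
    rw [hfun] at h1
    exact h2.unique h1
  exact hcomp.congr_of_eventuallyEq heq.symm

/-- **Each slice of the partial velocity is smooth**: under the same hypothesis the map
`y ↦ (f(y, t₀), ∂_t f(y, t₀)) ∈ TM` is `C^∞` at `y₀` (restriction to `N × {t₀}`). This is the
regularity of the velocity field `∂_t f(·, t₀)` along the map `f(·, t₀)`.
[cite: ONeill1983, Ch. 4, p. 122] -/
theorem contMDiffAt_lift_partialVelocity_slice {f : N × ℝ → M} {y₀ : N} {t₀ : ℝ}
    (hf : ∀ᶠ q in 𝓝 (y₀, t₀), ContMDiffAt (I'.prod 𝓘(ℝ, ℝ)) I ∞ f q) :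
    ContMDiffAt I' I.tangent ∞
      (fun y : N ↦ (TotalSpace.mk' E (f (y, t₀)) (velocity I (fun t : ℝ ↦ f (y, t)) t₀) :
        TangentBundle I M)) y₀ := by
  have h1 : ContMDiffAt I' (I'.prod 𝓘(ℝ, ℝ)) ∞ (fun y : N ↦ ((y, t₀) : N × ℝ)) y₀ :=
    contMDiffAt_id.prodMk contMDiffAt_const
  exact (contMDiffAt_lift_partialVelocity hf).comp y₀ h1

end Literature.Geometry.Lorentzian
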